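/-
Copyright (c) 2026 the pub-hodgecm-mathlib formalisation cell (harness21).  Prover seat hodgecm-mathlib-A-p19 (g26): «S3-ram» seeding wave (LEAD F0P3a-plan (g12) T11-40 (C)∕T11-41,
owner p06 (g15)), row «RANK-CM tame-ramified twin», the HEAD (r3); 2026-09-01.  Ported from ★ p846543 `UnipotentOrbitalIntegralLevelPiecesCM` (F0P3a-p08 (g18)).
-/
import Literature.NumberTheory.Rogawski1990.UnipotentOrbitalIntegralLevelPiecesRamifiedCM   -- ★ p846850 (this seat): the `v`-level-2 head + the SCALED-frame dictionary `…_of_smul`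
import Literature.NumberTheory.Rogawski1990.UnipotentLevelPiecesFrameCM                  -- ★ p846498 FILE 2a (F0P3a-p08): the frame dictionary `ψ = T·e(·)·T⁻¹` (place-generic given `hT hTint`); brings ★ FILE 1 `UnitaryThreeUnipotentClassesUnramified` (place-free `n(t)`∕`u(1,−t₀)` helpers), ★ FILE 0 `IntMatrixLevelConjugation`
import Literature.NumberTheory.Automorphic.OrbitalIntegralIndicatorSeparation          -- ★ p846366 the abstract RANK head `det_classOrbitalIntegral_indicator_ne_zero`
import Literature.NumberTheory.Automorphic.ResidueSquareClassLevelPiece                 -- ★ p846824 (this seat): the residue-square-class piece `P(c₀)` — membership, `1 ∉`, `Ad K`∕left-`K(ϖ²)` stability, separation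
import Literature.NumberTheory.Automorphic.UnitaryThreeUnipotentClassesRamifiedPlace     -- ★ p846845 (F0P3a-p08 (g18)) (r1-place): `exists_fixed_unit_norm_dichotomy_of_ramified_complexConj` (the non-norm unit `ε` and the `σ_w`-fixed dichotomy); brings ★ p846834 (r1), ★ p846833 (F0P2-p01) ramified unit norms
import Literature.GroupTheory.SpecificGroups.OrthogonalThreeUnipotentJordanClasses        -- ★ p846826 (F0P3-p03 (g14)): `mem_unitaryGroupOfForm_smul_iff` (`U(σ, c•J) = U(σ, J)`)
import Literature.NumberTheory.Automorphic.Liu2021.LemD1AsPrintedIndexedNonVacuityRamifiedPlace   -- ★ `ramificationIdx'_eq_two_of_ne_one`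
import Literature.NumberTheory.NumberFields.QuadraticCompletionIntegralBasis            -- ★ Q5 `valued_toPlace_of_ramificationIdx'_eq_two` (`|ι_w y|_w = |y|_v²` at `e = 2`)
import Literature.NumberTheory.Rogawski1990.UnitFundamentalLemmaInertFlickerFrame     -- ★ `isUnit_two_integer_iff_valued_eq_one`
import Literature.NumberTheory.Automorphic.FiniteAdeleFactorizable                     -- ★ `isClopen_setOf_valued_le` (closed valuation balls of `L_w` are clopen)
import HarnessLib

/-!
# RANK — THE U(3) INSTANTIATION AT A TAME-RAMIFIED PLACE, `v`-LEVEL ONE: reference pieces left-invariant under `K(ι ϖ_v) = K_w(2)` whose unipotent orbital integrals form an invertible matrix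

Topic `NumberTheory/Rogawski1990`; namespace `Literature.NumberTheory.Rogawski1990`.  THEOREMS ONLY (no definition, no instance, no notation, no named fact, no `sorry`); kernel
lane `--supports stmt-HodgeConjecture-24833`.  Cell `pub/hodgecm-mathlib` (D-0151), crux H413; road «S3-tree» residue programme «S3-res», tame-ramified sub-road «S3-ram» seeding wave
(LEAD F0P3a-plan (g12) T11-40 (C)∕T11-41; owner p06 (g15), row «RANK-CM tame-ramified twin»; S3-ram fold pen END F0P3a-p03 (g16)).  THIS FILE is the tame-RAMIFIED twin of ★ p846543
`exists_levelPieces_det_classOrbitalIntegral_ne_zero` (`stub_rankCM` at an unramified place): SAME CONCLUSION, binders `hv ↦ he : e(w|v) ≠ 1`, `h2` now used, and the integral antidiagonal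
frame `(T, hTint, hT)` of `H′_w` taken as a BINDER (its supply at a ramified place is Jacobowitz §8, a separate «(H2)-ram» row).
THE MATHEMATICS (obstruction note F0P3a-p08 (g18) 21:12Z, this seat 21:15Z).  At a tame-ramified `w` (`σ_w ϖ_w = −ϖ_w`, `σ̄_w = id`, `E⁰ = L⁺_v·ϖ_w`) the unipotent classes of
`U(σ_w, J₀)(L_w)` are `1`, the two transvection classes `[n(ϖ_w)]`, `[n(εϖ_w)]` (`ε` a `σ_w`-fixed unit congruent to NO norm — the residue non-square; every `σ_w`-fixed `s ≠ 0` is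
`N(z)` or `ε·N(z)`), and the regular class (unique, `|2| = 1`).  Both transvection classes have ALL their integral conjugates at ODD `ϖ_w`-levels `≥ 1`, so the unramified pieces
`K(1)∖K(2)`, `K∖K(1)` do not separate them (the second is even empty on both); the cure is ★ p846824's RESIDUE-SQUARE-CLASS PIECE `P(c) = {k ∈ K : ψk ≡ 1 (ϖ_w), ∃ x ∈ 𝒪³ ∃ y ∈ 𝒪^×,
|B₀(x,(ψk − 1)x) − ϖ_w·c·σy·y| < |ϖ_w|}`: with `P(1) := {ψ ≡ 1 (ι ϖ_v²)} = K(4)`, `P(tv₁) := P(1)`-piece of class `1`, `P(tv_ε) := P(ε)`, `P(reg) := R = {(ψk − 1)² ≢ 0 (ϖ_w)}` and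
the ranks `0 < 1 < 2 < 3` the table `(Φ_{mU}(u, 1_{P u′}))` is LOWER TRIANGULAR with non-zero diagonal: `1 ∉ P(c), R`; `n(ϖ_w) ∈ P(1)`, `n(εϖ_w) ∈ P(ε)`, `u(1,−½) ∈ R`; NO conjugate of
`n(ϖ_w)` lies in `P(ε)` (★ `conj_cornerUnipotent_not_mem_residueSquareClassPiece` with `ε ↦ ε⁻¹`); transvections miss `R`.  The pieces are clopen (left-stable under the OPEN subgroup
`K(ϖ_w²)`), inside `K`, `Ad K`-stable and left-stable under the socket's level set `{ψ ≡ 1 (ι ϖ_v²)} = K(ϖ_w⁴)`; ★ `det_classOrbitalIntegral_indicator_ne_zero` (p846366) gives `det ≠ 0`.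
HONEST LABEL: HC_CM is proved only modulo the 2 remaining named inputs (hLiu418 24832, h413 24833) until rung 0 closes; nothing printed is asserted here; count-neutral Literature
seeding of the «S3-ram» sub-road.

* **`exists_levelPieces_det_classOrbitalIntegral_ne_zero_ramified_levelOne`** — the RANK-ram socket of END's `_le_one`-ram WAYPOINT (fold v3): ★ p846850's statement with the
  single token edit `(toPlace v w ϖ_v) ^ 2 ↦ ^ 1` in the left-invariance conjunct (a STRONGER statement: fewer pieces qualify); proof = p846850's with `lev(−4) ↦ lev(−2)`.

## References
* [Rogawski1990] J. D. Rogawski, *Automorphic Representations of Unitary Groups in Three Variables*, Ann. of Math. Stud. 123 (1990), §8.1 pp. 112–114; §3.9 Prop. 3.9.1 p. 32; §4.9 p. 54.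
* [HarishChandra1999AdmissibleDistributions] Harish-Chandra, *Admissible Invariant Distributions on Reductive p-adic Groups*, AMS ULS 16 (1999), §3.1 p. 17.
* [Jacobowitz1962] R. Jacobowitz, *Hermitian forms over local fields*, Amer. J. Math. 84 (1962), §8 (ramified unimodular lattices).
* [Serre1979] J.-P. Serre, *Local Fields*, GTM 67 (1979), Ch. V §3 (norm groups of tamely ramified quadratic extensions).
-/

set_option autoImplicit false

noncomputable section

open scoped WithZero Matrix MatrixGroups ValuativeRel
open Topology Set NumberField IsDedekindDomain Matrix MeasureTheory

namespace Literature.NumberTheory.Rogawski1990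

open Literature.NumberTheory.Automorphic Literature.NumberTheory.Automorphic.UnitaryGroup Literature.NumberTheory.GaloisRepresentations
open Literature.NumberTheory.Automorphic.UnitaryLatticeTree Literature.NumberTheory.Automorphic.HermitianLattice Literature.MeasureTheory.Group
open Literature.NumberTheory.NumberFields
open Literature.GroupTheory.SpecificGroups (mem_unitaryGroupOfForm_smul_iff)




set_option maxHeartbeats 1600000 in
open scoped Classical in
/-- **‹RANK›, CM INSTANTIATION AT A TAME-RAMIFIED PLACE, `v`-LEVEL-ONE PIECES** (★ p846850 with the token `^ 1`; twin of ★ p846543 `stub_rankCM`): at a non-split place `v` with `e(w|v) ≠ 1`, `v ∤ 2`, and an 𝒪_w-integral antidiagonal frame `T` of `H′_w`, for every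
finite set `S` of UNIPOTENT classes of `U(H′)(L⁺_v)` and every orbital-measure family `mU` admissible on `S` with the Rao clause (the `∃`-data of ★ `ShalikaGermExpansionNonsplit`),
there are reference pieces `g_u ∈ C_c^∞` (`u ∈ S`) supported in the hyperspecial `K`, `Ad K`-invariant, left-invariant under the level-2 congruence set, with
`det (Φ_{mU}(u, g_{u′}))_{u,u′ ∈ S} ≠ 0` — the pieces `1_{K(ι ϖ_v²)}`, the two residue-square-class pieces `1_{P(1)}, 1_{P(ε)}` (★ p846824), `1_R`, lower-triangular in the rank order (★ p846366).
[cite: Rogawski1990, §8.1 Prop. 8.1.2 p. 114; §3.9 Prop. 3.9.1 p. 32; §4.9 p. 54] [cite: HarishChandra1999AdmissibleDistributions, §3.1 p. 17] [cite: Jacobowitz1962, §8] [cite: Serre1979, Ch. V §3] -/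
theorem exists_levelPieces_det_classOrbitalIntegral_ne_zero_ramified_levelOne
    (L : Type) [Field L] [NumberField L] [IsCMField L] (H' : Matrix (Fin 3) (Fin 3) L)
    {v : HeightOneSpectrum (𝓞 ↥(maximalRealSubfield L))}
    (_hH' : (H'.map (cmConjRingHom L)).transpose = H') (w : PlacesOver L v)
    (hw : IsCMField.complexConj L • w.1 = w.1) (he : v.asIdeal.ramificationIdx' w.1.asIdeal ≠ 1)
    (hH'w : IsUnit (placeForm H' w.1)) (_hH'i : hH'w.unit ∈ glInt 3 (w.1.adicCompletion L))
    (h2 : IsUnit (2 : 𝒪[w.1.adicCompletion L]))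
    -- the ramified block (R) and the integral antidiagonal frame of `H′_w` (★ `ramifiedBlock_adicCompletion`, ★ p846344) — SUPPLIED by the contract, BINDERS for the sockets
    (ϖ : w.1.adicCompletion L) (hϖ : Valued.v ϖ = WithZero.exp (-1 : ℤ)) (hσϖ : galAdicCompletionMap (L := L) (IsCMField.complexConj L) hw ϖ = -ϖ)
    (A : GL (Fin 3) (w.1.adicCompletion L)) (hA : A ∈ glInt 3 (w.1.adicCompletion L))
    (hframe : placeForm H' w.1 = (-(placeForm H' w.1).det) • formCongr (galAdicCompletionMap (L := L) (IsCMField.complexConj L) hw) A ((StdForm.antidiagonal 3).over (w.1.adicCompletion L)))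
    [MeasurableSpace ((cmDatum L 3 H').Local v)] [BorelSpace ((cmDatum L 3 H').Local v)]
    [∀ γ : ((cmDatum L 3 H').Local v), MeasurableSpace (((cmDatum L 3 H').Local v) ⧸ Subgroup.centralizer ({γ} : Set ((cmDatum L 3 H').Local v)))]
    [∀ γ : ((cmDatum L 3 H').Local v), BorelSpace (((cmDatum L 3 H').Local v) ⧸ Subgroup.centralizer ({γ} : Set ((cmDatum L 3 H').Local v)))]
    -- the unipotent datum: conjuncts (i)–(iii) of ★ `ShalikaGermExpansionNonsplit` VERBATIM
    (S : Finset (ConjClasses ((cmDatum L 3 H').Local v)))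
    (hS : ∀ u ∈ S, (((Quotient.out u : (cmDatum L 3 H').Local v).val : GL (Fin 3) (UnitaryGroup.LocalRing L v)).val - 1) ^ 3 = 0)
    (mU : OrbitalMeasureFamily ((cmDatum L 3 H').Local v)) (hmU : mU.IsAdmissibleOn (fun γ => (ConjClasses.mk γ) ∈ S))
    (hRao : ∀ u ∈ S, ∀ f : (cmDatum L 3 H').Local v → ℂ, IsLocSmooth f →
      Integrable (descConj (Quotient.out u : (cmDatum L 3 H').Local v)
        (Subgroup.centralizer ({(Quotient.out u : (cmDatum L 3 H').Local v)} : Set ((cmDatum L 3 H').Local v)))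
        (fun _ hg => Subgroup.mem_centralizer_singleton_iff.1 hg) f) (mU u)) :
    ∃ gref : ↥S → ((cmDatum L 3 H').Local v) → ℂ,
      (∀ i, IsLocSmooth (gref i)) ∧
      (∀ i, tsupport (gref i) ⊆ (cmLocalIntegralLevel L 3 H' v : Set ((cmDatum L 3 H').Local v))) ∧
      (∀ i, ∀ u ∈ cmLocalIntegralLevel L 3 H' v, ∀ x, gref i (u * x * u⁻¹) = gref i x) ∧
      (∀ i, ∀ u : (cmDatum L 3 H').Local v,
        (∀ a b, Valued.v (((toPlace v w (HeckeCharacter.uniformizer ↥(maximalRealSubfield L) v : v.adicCompletion ↥(maximalRealSubfield L))) ^ 1)⁻¹ *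
          ((((localNonsplitEquiv (IsCMField.complexConj L) H' (IsCMField.complexConj_ne_one L) w hw u :
              ↥(unitaryGroupOfForm (galAdicCompletionMap (L := L) (IsCMField.complexConj L) hw) (placeForm H' w.1))) : GL (Fin 3) (w.1.adicCompletion L)) :
                Matrix (Fin 3) (Fin 3) (w.1.adicCompletion L)) a b - (1 : Matrix (Fin 3) (Fin 3) (w.1.adicCompletion L)) a b)) ≤ 1) →
        ∀ x, gref i (u * x) = gref i x) ∧
      (Matrix.of fun u u' : ↥S => classOrbitalIntegral mU (gref u') u).det ≠ 0 := by
  classical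
  -- ## 0. The frame `ψ = T·e(·)·T⁻¹ : G′_v → U(σ_w, J₀)(L_w)` (a binder here; ★ FILE 2a dictionary) and the RAMIFIED datum at `w`
  haveI : Algebra.IsQuadraticExtension ↥(maximalRealSubfield L) L := IsCMField.isQuadraticExtension L
  set T : GL (Fin 3) (w.1.adicCompletion L) := A with hTA
  have hTint : T ∈ glInt 3 (w.1.adicCompletion L) := hA
  have ha : (-(placeForm H' w.1).det) ≠ 0 := neg_ne_zero.2 ((Matrix.isUnit_iff_isUnit_det _).1 hH'w).ne_zero
  have hT : placeForm H' w.1 = (-(placeForm H' w.1).det) • formCongr (galAdicCompletionMap (L := L) (IsCMField.complexConj L) hw) T ((StdForm.antidiagonal 3).over (w.1.adicCompletion L)) := hframe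
  obtain ⟨hTi, hTii⟩ := isIntMatrix_frame L v w hTint
  obtain ⟨ψ, hψ⟩ : ∃ ψ : (cmDatum L 3 H').Local v → GL (Fin 3) (w.1.adicCompletion L), ∀ y, ψ y =
      T * ((localNonsplitEquiv (IsCMField.complexConj L) H' (IsCMField.complexConj_ne_one L) w hw y :
        ↥(unitaryGroupOfForm (galAdicCompletionMap (L := L) (IsCMField.complexConj L) hw) (placeForm H' w.1))) : GL (Fin 3) (w.1.adicCompletion L)) * T⁻¹ :=
    ⟨_, fun _ => rfl⟩
  -- the `ψ`-dictionary (★ FILE 2a, rewritten through `hψ`)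
  have hψU : ∀ y, ψ y ∈ unitaryGroupOfForm (galAdicCompletionMap (L := L) (IsCMField.complexConj L) hw) ((StdForm.antidiagonal 3).over (w.1.adicCompletion L)) :=
    fun y => by rw [hψ]; exact conj_localNonsplitEquiv_mem_of_smul L H' v w hw ha hT y
  have hψmul : ∀ y y', ψ (y * y') = ψ y * ψ y' := fun y y' => by simp only [hψ]; exact conj_localNonsplitEquiv_mul L H' v w hw y y'
  have hψinv : ∀ y, ψ y⁻¹ = (ψ y)⁻¹ := fun y => by simp only [hψ]; exact conj_localNonsplitEquiv_inv L H' v w hw y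
  have hψsurj : ∀ g ∈ unitaryGroupOfForm (galAdicCompletionMap (L := L) (IsCMField.complexConj L) hw) ((StdForm.antidiagonal 3).over (w.1.adicCompletion L)),
      ∃ y, ψ y = g := fun g hg => by simp only [hψ]; exact exists_conj_localNonsplitEquiv_eq_of_smul L H' v w hw ha hT hg
  have hψK : ∀ y, y ∈ cmLocalIntegralLevel L 3 H' v ↔ IsIntMatrix ((ψ y : GL (Fin 3) (w.1.adicCompletion L)) : Matrix (Fin 3) (Fin 3) (w.1.adicCompletion L)) :=
    fun y => by rw [hψ]; exact mem_cmLocalIntegralLevel_iff_isIntMatrix_conj_of_smul L H' v w hw ha hT hTint y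
  have hψconj : ∀ y y', ConjClasses.mk y = ConjClasses.mk y' ↔
      ∃ k : GL (Fin 3) (w.1.adicCompletion L), k ∈ unitaryGroupOfForm (galAdicCompletionMap (L := L) (IsCMField.complexConj L) hw)
        ((StdForm.antidiagonal 3).over (w.1.adicCompletion L)) ∧ k * ψ y * k⁻¹ = ψ y' :=
    fun y y' => by simp only [hψ]; exact conjClasses_mk_eq_iff_exists_conj_of_smul L H' v w hw ha hT y y'
  have hψcont : ∀ a b, Continuous fun y => ((ψ y : GL (Fin 3) (w.1.adicCompletion L)) : Matrix (Fin 3) (Fin 3) (w.1.adicCompletion L)) a b := fun a b => by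
    simp only [hψ]; exact continuous_conj_localNonsplitEquiv_apply L H' v w hw a b
  have hψnil : ∀ u ∈ S, (((ψ (Quotient.out u) : GL (Fin 3) (w.1.adicCompletion L)) : Matrix (Fin 3) (Fin 3) (w.1.adicCompletion L)) - 1) ^ 3 = 0 :=
    fun u hu => by rw [hψ]; exact conj_localNonsplitEquiv_sub_one_pow_eq_zero L H' v w hw (hS u hu)
  have hout : ∀ c : ConjClasses ((cmDatum L 3 H').Local v), ConjClasses.mk (Quotient.out c) = c := fun c => by
    rw [← ConjClasses.quotient_mk_eq_mk, Quotient.out_eq]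
  -- the ramified datum at `w`: `ϖ` with `σ_w ϖ = −ϖ` (a binder); `σ_w` an isometric involution; `|2| = 1`; the non-norm unit `ε` and
  -- the dichotomy of `σ_w`-fixed elements ((r1))
  have hv2 : Valued.v (2 : w.1.adicCompletion L) = 1 := (isUnit_two_integer_iff_valued_eq_one (L := L) w.1).1 h2
  have hσσ := galAdicCompletionMap_galAdicCompletionMap_of_smul_eq (IsCMField.complexConj L) w (IsCMField.complexConj_ne_one L) hw
  have hvσ : ∀ x, Valued.v ((galAdicCompletionMap (L := L) (IsCMField.complexConj L) hw) x) = Valued.v x :=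
    fun x => (v_eq_iff_valuation_eq _ _).2 (valuation_galAdicCompletionMap_eq (IsCMField.complexConj L) v w hw x)
  obtain ⟨ε, hσε, hεv, hε, -, hdich⟩ := exists_fixed_unit_norm_dichotomy_of_ramified_complexConj L w hw he hv2
  have hϖ0 : ϖ ≠ 0 := fun h0 => by rw [h0, map_zero] at hϖ; exact WithZero.zero_ne_coe hϖ
  have hε0 : ε ≠ 0 := fun h0 => by rw [h0, map_zero] at hεv; exact zero_ne_one hεv
  haveI : CharZero (w.1.adicCompletion L) := charZero_of_injective_algebraMap (algebraMap L _).injective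
  have h2K : (2 : w.1.adicCompletion L) ≠ 0 := two_ne_zero
  -- the trace element `t₀ = ½`
  have ht₀ : Valued.v ((2 : w.1.adicCompletion L)⁻¹) ≤ 1 := by rw [map_inv₀, hv2, inv_one]
  have htr : (2 : w.1.adicCompletion L)⁻¹ + (galAdicCompletionMap (L := L) (IsCMField.complexConj L) hw) (2 : w.1.adicCompletion L)⁻¹ = 1 := by
    rw [map_inv₀, map_ofNat]; field_simp; norm_num
  -- `ε⁻¹` is congruent to no norm either
  have hε' : ∀ z : w.1.adicCompletion L, Valued.v z ≤ 1 → Valued.v (ε⁻¹ - (galAdicCompletionMap (L := L) (IsCMField.complexConj L) hw) z * z) = 1 := by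
    intro z hz
    by_contra hne
    have hlt : Valued.v (ε⁻¹ - (galAdicCompletionMap (L := L) (IsCMField.complexConj L) hw) z * z) < 1 := by
      rcases lt_or_gt_of_ne hne with h | h
      · exact h
      · exfalso
        have hle : Valued.v (ε⁻¹ - (galAdicCompletionMap (L := L) (IsCMField.complexConj L) hw) z * z) ≤ 1 := by
          refine le_trans (Valuation.map_sub _ _ _) (max_le ?_ ?_)
          · rw [map_inv₀, hεv, inv_one]
          · rw [map_mul, hvσ]; exact mul_le_one' hz hz
        exact absurd (lt_of_le_of_lt hle h) (lt_irrefl _)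
    -- `ε⁻¹ ≡ N z` forces `|z| = 1` and `ε ≡ N z⁻¹`
    have hz1 : Valued.v z = 1 := by
      by_contra hz1
      have hzlt : Valued.v z < 1 := lt_of_le_of_ne hz hz1
      have hNlt : Valued.v ((galAdicCompletionMap (L := L) (IsCMField.complexConj L) hw) z * z) < Valued.v ε⁻¹ := by
        rw [map_mul, hvσ, map_inv₀, hεv, inv_one]
        calc Valued.v z * Valued.v z ≤ Valued.v z * 1 := mul_le_mul' le_rfl hz
          _ < 1 := by rw [mul_one]; exact hzlt
      have := Valuation.map_sub_eq_of_lt_left _ hNlt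
      rw [this, map_inv₀, hεv, inv_one] at hlt
      exact lt_irrefl _ hlt
    have hz0 : z ≠ 0 := fun h0 => by rw [h0, map_zero] at hz1; exact zero_ne_one hz1
    have hσz0 : (galAdicCompletionMap (L := L) (IsCMField.complexConj L) hw) z ≠ 0 := (_root_.map_ne_zero _).2 hz0
    have hkey : ε - (galAdicCompletionMap (L := L) (IsCMField.complexConj L) hw) z⁻¹ * z⁻¹ = -(ε * ((galAdicCompletionMap (L := L) (IsCMField.complexConj L) hw) z * z)⁻¹) * (ε⁻¹ - (galAdicCompletionMap (L := L) (IsCMField.complexConj L) hw) z * z) := by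
      rw [map_inv₀]; field_simp; ring
    have h1 := hε z⁻¹ (by rw [map_inv₀, hz1, inv_one])
    rw [hkey, map_mul, Valuation.map_neg, map_mul, map_inv₀, map_mul, hvσ, hz1, hεv, mul_one, inv_one, mul_one, one_mul] at h1
    rw [h1] at hlt
    exact lt_irrefl _ hlt
  -- the representatives `n₁ = n(ϖ)` (written `n(1·ϖ)`), `n₀ = n(εϖ)`, `u_reg = u(1, −½)` in `U(σ_w, J₀)(L_w)`
  obtain ⟨n₁, hn₁⟩ := exists_units_coe_eq_cornerUnipotent' ((1 : w.1.adicCompletion L) * ϖ)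
  obtain ⟨n₀, hn₀⟩ := exists_units_coe_eq_cornerUnipotent' (ε * ϖ)
  obtain ⟨ur, hur, -⟩ := exists_units_coe_eq_upperTriangularUnipotent (1 : w.1.adicCompletion L) (-(2 : w.1.adicCompletion L)⁻¹) (-1)
  obtain ⟨IsCj, hIsCj⟩ : ∃ IsCj : GL (Fin 3) (w.1.adicCompletion L) → GL (Fin 3) (w.1.adicCompletion L) → Prop, ∀ g n, IsCj g n ↔
      ∃ k : GL (Fin 3) (w.1.adicCompletion L), k ∈ unitaryGroupOfForm (galAdicCompletionMap (L := L) (IsCMField.complexConj L) hw) ((StdForm.antidiagonal 3).over (w.1.adicCompletion L)) ∧ k * g * k⁻¹ = n := ⟨_, fun _ _ => Iff.rfl⟩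
  have hn₀' : ((n₀ : GL (Fin 3) (w.1.adicCompletion L)) : Matrix (Fin 3) (Fin 3) (w.1.adicCompletion L)) = !![1, 0, ε * 1 * ϖ; 0, 1, 0; 0, 0, 1] := by rw [mul_one]; exact hn₀
  have hn₁' : ((n₁ : GL (Fin 3) (w.1.adicCompletion L)) : Matrix (Fin 3) (Fin 3) (w.1.adicCompletion L)) = !![1, 0, ε⁻¹ * ε * ϖ; 0, 1, 0; 0, 0, 1] := by rw [inv_mul_cancel₀ hε0]; exact hn₁
  have hσ1 : (galAdicCompletionMap (L := L) (IsCMField.complexConj L) hw) ((1 : w.1.adicCompletion L) * ϖ) = -((1 : w.1.adicCompletion L) * ϖ) := by rw [one_mul, hσϖ]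
  have hσ0 : (galAdicCompletionMap (L := L) (IsCMField.complexConj L) hw) (ε * ϖ) = -(ε * ϖ) := by rw [map_mul, hσε, hσϖ, mul_neg]
  have hv1 : Valued.v ((1 : w.1.adicCompletion L) * ϖ) = WithZero.exp (-1 : ℤ) := by rw [one_mul, hϖ]
  have hv0 : Valued.v (ε * ϖ) = WithZero.exp (-1 : ℤ) := by rw [map_mul, hεv, one_mul, hϖ]
  have hn₀U : n₀ ∈ unitaryGroupOfForm (galAdicCompletionMap (L := L) (IsCMField.complexConj L) hw) ((StdForm.antidiagonal 3).over (w.1.adicCompletion L)) :=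
    (mem_unitaryGroupOfForm_iff_of_coe_eq_cornerUnipotent _ hn₀).2 (by rw [hσ0, neg_add_cancel])
  have hn₁U : n₁ ∈ unitaryGroupOfForm (galAdicCompletionMap (L := L) (IsCMField.complexConj L) hw) ((StdForm.antidiagonal 3).over (w.1.adicCompletion L)) :=
    (mem_unitaryGroupOfForm_iff_of_coe_eq_cornerUnipotent _ hn₁).2 (by rw [hσ1, neg_add_cancel])
  obtain ⟨hurU, hurint, -, hurreg, hurnil⟩ := upperUnipotentOne_facts (galAdicCompletionMap (L := L) (IsCMField.complexConj L) hw) hσσ ht₀ htr hur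
  -- the ramified classification of square-zero unipotents: `1`, `[n(ϖ)]`, `[n(εϖ)]` ((r1)(ii) + ★ `exists_conj_coe_eq_cornerUnipotent_of_sq_eq_zero` + ★ `exists_conj_eq_iff_exists_norm_mul`)
  have hsqcases : ∀ g : GL (Fin 3) (w.1.adicCompletion L), g ∈ unitaryGroupOfForm (galAdicCompletionMap (L := L) (IsCMField.complexConj L) hw) ((StdForm.antidiagonal 3).over (w.1.adicCompletion L)) →
      ((g : Matrix (Fin 3) (Fin 3) (w.1.adicCompletion L)) - 1) * ((g : Matrix (Fin 3) (Fin 3) (w.1.adicCompletion L)) - 1) = 0 → g = 1 ∨ IsCj g n₁ ∨ IsCj g n₀ := by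
    intro g hg hsq
    by_cases hg1 : g = 1
    · exact Or.inl hg1
    obtain ⟨k, hk, t, hσt, hkgk⟩ := exists_conj_coe_eq_cornerUnipotent_of_sq_eq_zero (galAdicCompletionMap (L := L) (IsCMField.complexConj L) hw) hσσ hg hsq
    have ht0 : t ≠ 0 := by
      intro ht0
      apply hg1
      have h1 : ((k * g * k⁻¹ : GL (Fin 3) (w.1.adicCompletion L)) : Matrix (Fin 3) (Fin 3) (w.1.adicCompletion L)) = 1 := by
        rw [hkgk, ht0]; ext i j; fin_cases i <;> fin_cases j <;> rfl
      have h2 : k * g * k⁻¹ = 1 := Units.val_eq_one.1 h1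
      calc g = k⁻¹ * (k * g * k⁻¹) * k := by group
        _ = 1 := by rw [h2]; group
    -- `s := t ∕ ϖ` is `σ_w`-fixed, hence `N(z)` or `ε N(z)`
    have hσs : (galAdicCompletionMap (L := L) (IsCMField.complexConj L) hw) (t / ϖ) = t / ϖ := by
      rw [map_div₀, hσϖ, show (galAdicCompletionMap (L := L) (IsCMField.complexConj L) hw) t = -t by linear_combination hσt, neg_div_neg_eq]
    obtain ⟨z, hz0, hz⟩ := hdich (t / ϖ) (div_ne_zero ht0 hϖ0) hσs
    -- `n(t)` is conjugate to `n(1·ϖ)` or to `n(εϖ)`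
    have hconj : ∀ {t' : w.1.adicCompletion L} {n' : GL (Fin 3) (w.1.adicCompletion L)}, ((n' : GL (Fin 3) (w.1.adicCompletion L)) : Matrix (Fin 3) (Fin 3) (w.1.adicCompletion L)) = !![1, 0, t'; 0, 1, 0; 0, 0, 1] →
        t = z * (galAdicCompletionMap (L := L) (IsCMField.complexConj L) hw) z * t' → IsCj g n' := by
      intro t' n' hn' htt'
      have ht'0 : t' ≠ 0 := by rintro rfl; rw [mul_zero] at htt'; exact ht0 htt'
      obtain ⟨k', hk', hk'n⟩ := (exists_conj_eq_iff_exists_norm_mul (galAdicCompletionMap (L := L) (IsCMField.complexConj L) hw) hσσ ht'0 hn' hkgk).2 ⟨z, hz0, htt'⟩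
      rw [hIsCj]
      refine ⟨k'⁻¹ * k, mul_mem (inv_mem hk') hk, ?_⟩
      rw [show k'⁻¹ * k * g * (k'⁻¹ * k)⁻¹ = k'⁻¹ * (k * g * k⁻¹) * k' by group, ← hk'n]
      group
    rcases hz with hz | hz
    · refine Or.inr (Or.inl (hconj hn₁ ?_))
      rw [one_mul, ← hz]; field_simp
    · refine Or.inr (Or.inr (hconj hn₀ ?_))
      rw [show z * (galAdicCompletionMap (L := L) (IsCMField.complexConj L) hw) z * (ε * ϖ) = ε * (z * (galAdicCompletionMap (L := L) (IsCMField.complexConj L) hw) z) * ϖ by ring, ← hz]; field_simp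
  have hexp21 : WithZero.exp (-2 : ℤ) ≤ WithZero.exp (-1 : ℤ) := WithZero.exp_le_exp.2 (by norm_num)
  have hexp20 : WithZero.exp (-2 : ℤ) ≤ (1 : ℤᵐ⁰) := by rw [← WithZero.exp_zero]; exact WithZero.exp_le_exp.2 (by norm_num)
  have hexp1lt : WithZero.exp (-1 : ℤ) < (1 : ℤᵐ⁰) := by rw [← WithZero.exp_zero]; exact WithZero.exp_lt_exp.2 (by norm_num)
  have hϖ1 : Valued.v ϖ < 1 := by rw [hϖ]; exact hexp1lt
  have hϖsq : Valued.v ϖ ^ 2 = WithZero.exp (-2 : ℤ) := by rw [hϖ, ← WithZero.exp_nsmul]; norm_num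
  -- ## 1. The level predicates through `ψ` and the rank of a class
  obtain ⟨lev, hlev⟩ : ∃ lev : ℤ → (cmDatum L 3 H').Local v → Prop, ∀ m y, lev m y ↔
      ∀ a b, Valued.v ((((ψ y : GL (Fin 3) (w.1.adicCompletion L)) : Matrix (Fin 3) (Fin 3) (w.1.adicCompletion L)) - 1) a b) ≤ WithZero.exp m := ⟨_, fun _ _ => Iff.rfl⟩
  obtain ⟨sq1, hsq1⟩ : ∃ sq1 : (cmDatum L 3 H').Local v → Prop, ∀ y, sq1 y ↔
      ∀ a b, Valued.v (((((ψ y : GL (Fin 3) (w.1.adicCompletion L)) : Matrix (Fin 3) (Fin 3) (w.1.adicCompletion L)) - 1) *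
        (((ψ y : GL (Fin 3) (w.1.adicCompletion L)) : Matrix (Fin 3) (Fin 3) (w.1.adicCompletion L)) - 1)) a b) ≤ WithZero.exp (-1 : ℤ) := ⟨_, fun _ => Iff.rfl⟩
  obtain ⟨b, hb⟩ : ∃ b : ConjClasses ((cmDatum L 3 H').Local v) → ℕ, ∀ c, b c =
      if ψ (Quotient.out c) = 1 then 0 else if IsCj (ψ (Quotient.out c)) n₁ then 1 else if IsCj (ψ (Quotient.out c)) n₀ then 2 else 3 := ⟨_, fun _ => rfl⟩
  -- the residue-square-class test of ★ p846824 through `ψ`, with constant `c`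
  obtain ⟨pc, hpc⟩ : ∃ pc : (w.1.adicCompletion L) → (cmDatum L 3 H').Local v → Prop, ∀ c y, pc c y ↔
      IsIntMatrix ((ψ y : GL (Fin 3) (w.1.adicCompletion L)) : Matrix (Fin 3) (Fin 3) (w.1.adicCompletion L)) ∧
      (∀ a b, Valued.v ((((ψ y : GL (Fin 3) (w.1.adicCompletion L)) : Matrix (Fin 3) (Fin 3) (w.1.adicCompletion L)) - 1) a b) ≤ Valued.v ϖ) ∧
      ∃ x : Fin 3 → (w.1.adicCompletion L), (∀ i, Valued.v (x i) ≤ 1) ∧ ∃ yy : (w.1.adicCompletion L), Valued.v yy = 1 ∧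
        Valued.v (B₀ (galAdicCompletionMap (L := L) (IsCMField.complexConj L) hw) 3 x ((((ψ y : GL (Fin 3) (w.1.adicCompletion L)) : Matrix (Fin 3) (Fin 3) (w.1.adicCompletion L)) - 1) *ᵥ x) - ϖ * c * ((galAdicCompletionMap (L := L) (IsCMField.complexConj L) hw) yy * yy)) < Valued.v ϖ :=
    ⟨_, fun _ _ => Iff.rfl⟩
  obtain ⟨P, hP⟩ : ∃ P : ConjClasses ((cmDatum L 3 H').Local v) → Set ((cmDatum L 3 H').Local v), ∀ c, P c =
      if b c = 0 then {y | y ∈ cmLocalIntegralLevel L 3 H' v ∧ lev (-2) y}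
      else if b c = 1 then {y | pc 1 y}
      else if b c = 2 then {y | pc ε y}
      else {y | y ∈ cmLocalIntegralLevel L 3 H' v ∧ ¬ sq1 y} := ⟨_, fun _ => rfl⟩
  -- ## 2. Topology and invariance of the level sets
  obtain ⟨hKc, hKo⟩ := isCompact_isOpen_cmLocalIntegralLevel L 3 H' v
  have hKcl : IsClosed (cmLocalIntegralLevel L 3 H' v : Set ((cmDatum L 3 H').Local v)) := (cmLocalIntegralLevel L 3 H' v).isClosed_of_isOpen hKo
  have hball : ∀ m : ℤ, IsClopen {x : w.1.adicCompletion L | Valued.v x ≤ WithZero.exp m} := fun m =>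
    isClopen_setOf_valued_le L w.1 WithZero.exp_ne_zero
  have hψcontM : Continuous fun y => ((ψ y : GL (Fin 3) (w.1.adicCompletion L)) : Matrix (Fin 3) (Fin 3) (w.1.adicCompletion L)) :=
    continuous_pi fun a => continuous_pi fun c => hψcont a c
  have hlev_clopen : ∀ m, IsClopen {y | lev m y} := by
    intro m
    have hset : {y | lev m y} = ⋂ a : Fin 3, ⋂ c : Fin 3,
        (fun y => ((((ψ y : GL (Fin 3) (w.1.adicCompletion L)) : Matrix (Fin 3) (Fin 3) (w.1.adicCompletion L)) - 1) a c)) ⁻¹'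
          {x : w.1.adicCompletion L | Valued.v x ≤ WithZero.exp m} := by
      ext y; simp only [Set.mem_setOf_eq, hlev, Set.mem_iInter, Set.mem_preimage]
    rw [hset]
    exact isClopen_iInter_of_finite fun a => isClopen_iInter_of_finite fun c => (hball m).preimage ((hψcontM.sub continuous_const).matrix_elem a c)
  have hsq1_clopen : IsClopen {y | sq1 y} := by
    have hset : {y | sq1 y} = ⋂ a : Fin 3, ⋂ c : Fin 3,
        (fun y => (((((ψ y : GL (Fin 3) (w.1.adicCompletion L)) : Matrix (Fin 3) (Fin 3) (w.1.adicCompletion L)) - 1) *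
          (((ψ y : GL (Fin 3) (w.1.adicCompletion L)) : Matrix (Fin 3) (Fin 3) (w.1.adicCompletion L)) - 1)) a c)) ⁻¹'
          {x : w.1.adicCompletion L | Valued.v x ≤ WithZero.exp (-1 : ℤ)} := by
      ext y; simp only [Set.mem_setOf_eq, hsq1, Set.mem_iInter, Set.mem_preimage]
    rw [hset]
    exact isClopen_iInter_of_finite fun a => isClopen_iInter_of_finite fun c =>
      (hball (-1)).preimage (((hψcontM.sub continuous_const).mul (hψcontM.sub continuous_const)).matrix_elem a c)
  -- `Ad K`-invariance and left-invariance of the basic predicates (★ FILE 0, ★ p846824)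
  have hconjK : ∀ k ∈ cmLocalIntegralLevel L 3 H' v, ∀ y, k * y * k⁻¹ ∈ cmLocalIntegralLevel L 3 H' v ↔ y ∈ cmLocalIntegralLevel L 3 H' v := by
    intro k hk y
    refine ⟨fun h => ?_, fun h => mul_mem (mul_mem hk h) (inv_mem hk)⟩
    have h' := mul_mem (mul_mem (inv_mem hk) h) hk
    rwa [show k⁻¹ * (k * y * k⁻¹) * k = y by group] at h'
  have hψKinv : ∀ k ∈ cmLocalIntegralLevel L 3 H' v,
      IsIntMatrix (((ψ k)⁻¹ : GL (Fin 3) (w.1.adicCompletion L)) : Matrix (Fin 3) (Fin 3) (w.1.adicCompletion L)) := fun k hk => by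
    rw [← hψinv]; exact (hψK k⁻¹).1 (inv_mem hk)
  have hconj_lev : ∀ k ∈ cmLocalIntegralLevel L 3 H' v, ∀ m y, lev m (k * y * k⁻¹) ↔ lev m y := by
    intro k hk m y
    rw [hlev, hlev, hψmul, hψmul, hψinv]
    exact forall_v_conj_sub_one_apply_le_iff ((hψK k).1 hk) (hψKinv k hk) (ψ y) _
  have hconj_sq1 : ∀ k ∈ cmLocalIntegralLevel L 3 H' v, ∀ y, sq1 (k * y * k⁻¹) ↔ sq1 y := by
    intro k hk y
    rw [hsq1, hsq1, hψmul, hψmul, hψinv]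
    exact forall_v_conj_sub_one_sq_apply_le_iff ((hψK k).1 hk) (hψKinv k hk) (ψ y) _
  have hconj_pc1 : ∀ c, ∀ k ∈ cmLocalIntegralLevel L 3 H' v, ∀ y, pc c y → pc c (k * y * k⁻¹) := by
    intro c k hk y hy
    rw [hpc] at hy ⊢
    rw [hψmul, hψmul, hψinv]
    exact conj_mem_residueSquareClassPiece (galAdicCompletionMap (L := L) (IsCMField.complexConj L) hw) (hψU k) ((hψK k).1 hk) (hψKinv k hk) hy
  have hconj_pc : ∀ c, ∀ k ∈ cmLocalIntegralLevel L 3 H' v, ∀ y, pc c (k * y * k⁻¹) ↔ pc c y := by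
    intro c k hk y
    refine ⟨fun h => ?_, hconj_pc1 c k hk y⟩
    have h' := hconj_pc1 c k⁻¹ (inv_mem hk) _ h
    rwa [show k⁻¹ * (k * y * k⁻¹) * k⁻¹⁻¹ = y by group] at h'
  have hmulK : ∀ u ∈ cmLocalIntegralLevel L 3 H' v, ∀ y, u * y ∈ cmLocalIntegralLevel L 3 H' v ↔ y ∈ cmLocalIntegralLevel L 3 H' v :=
    fun u hu y => Subgroup.mul_mem_cancel_left _ hu
  -- a `lev (−2)` element of `K` has a `lev (−2)` inverse
  have hlev2_inv : ∀ u ∈ cmLocalIntegralLevel L 3 H' v, lev (-2) u → lev (-2) u⁻¹ := by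
    intro u hu hu2
    rw [hlev] at hu2 ⊢
    rw [hψinv]
    have hrew : (((ψ u)⁻¹ : GL (Fin 3) (w.1.adicCompletion L)) : Matrix (Fin 3) (Fin 3) (w.1.adicCompletion L)) - 1 = -((((ψ u)⁻¹ : GL (Fin 3) (w.1.adicCompletion L)) : Matrix (Fin 3) (Fin 3) (w.1.adicCompletion L)) * ((((ψ u : GL (Fin 3) (w.1.adicCompletion L)) : Matrix (Fin 3) (Fin 3) (w.1.adicCompletion L))) - 1) * 1) := by
      rw [Matrix.mul_one, Matrix.mul_sub, Matrix.mul_one, ← Units.val_mul, inv_mul_cancel, Units.val_one, neg_sub]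
    intro a b
    rw [hrew, Matrix.neg_apply, Valuation.map_neg]
    exact forall_v_mul_mul_apply_le (hψKinv u hu) isIntMatrix_one hu2 a b
  have hmul_lev : ∀ u, lev (-2) u → ∀ y ∈ cmLocalIntegralLevel L 3 H' v, ∀ m, m = -1 ∨ m = -2 → (lev m (u * y) ↔ lev m y) := by
    intro u hu2 y hy m hm
    rw [hlev, hlev, hψmul]
    refine forall_v_mul_sub_one_apply_le_iff ((hlev (-2) u).1 hu2) ((hψK y).1 hy) ?_
    rcases hm with rfl | rfl <;> [exact hexp21; exact le_rfl]
  have hmul_sq1 : ∀ u, lev (-2) u → ∀ y ∈ cmLocalIntegralLevel L 3 H' v, (sq1 (u * y) ↔ sq1 y) := by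
    intro u hu2 y hy
    rw [hsq1, hsq1, hψmul]
    exact forall_v_mul_sub_one_sq_apply_le_iff ((hlev (-2) u).1 hu2) ((hψK y).1 hy) hexp21 hexp20
  have hmul_pc1 : ∀ c, ∀ u ∈ cmLocalIntegralLevel L 3 H' v, lev (-2) u → ∀ y, pc c y → pc c (u * y) := by
    intro c u hu hu2 y hy
    rw [hpc] at hy ⊢
    rw [hψmul]
    refine mul_mem_residueSquareClassPiece (galAdicCompletionMap (L := L) (IsCMField.complexConj L) hw) hvσ hϖ1 hϖ0 ((hψK u).1 hu) (fun a b => ?_) hy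
    rw [hϖsq]; exact (hlev (-2) u).1 hu2 a b
  have hmul_pc : ∀ c, ∀ u ∈ cmLocalIntegralLevel L 3 H' v, lev (-2) u → ∀ y, pc c (u * y) ↔ pc c y := by
    intro c u hu hu2 y
    refine ⟨fun h => ?_, hmul_pc1 c u hu hu2 y⟩
    have h' := hmul_pc1 c u⁻¹ (inv_mem hu) (hlev2_inv u hu hu2) _ h
    rwa [inv_mul_cancel_left] at h'
  -- the residue-square-class pieces are clopen: both `{pc c}` and its complement are unions of right cosets of the OPEN set `K ∩ {lev (−2)}`
  have hV_open : IsOpen {u : (cmDatum L 3 H').Local v | u ∈ cmLocalIntegralLevel L 3 H' v ∧ lev (-2) u} := hKo.inter (hlev_clopen (-2)).isOpen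
  have hsat_open : ∀ s : Set ((cmDatum L 3 H').Local v), (∀ u ∈ cmLocalIntegralLevel L 3 H' v, lev (-2) u → ∀ y, u * y ∈ s ↔ y ∈ s) → IsOpen s := by
    intro s hs
    rw [isOpen_iff_forall_mem_open]
    intro y hy
    refine ⟨(fun z => z * y⁻¹) ⁻¹' {u | u ∈ cmLocalIntegralLevel L 3 H' v ∧ lev (-2) u}, fun z hz => ?_, hV_open.preimage (continuous_id.mul continuous_const), ?_⟩
    · have h := (hs (z * y⁻¹) hz.1 hz.2 y).2 hy
      rwa [inv_mul_cancel_right] at h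
    · refine ⟨?_, ?_⟩
      · show y * y⁻¹ ∈ cmLocalIntegralLevel L 3 H' v
        rw [mul_inv_cancel]; exact one_mem _
      · show lev (-2) (y * y⁻¹)
        rw [mul_inv_cancel, hlev, hψ]
        intro a b
        rw [conj_localNonsplitEquiv_one L H' v w hw, Units.val_one, sub_self, Matrix.zero_apply, map_zero]; exact zero_le
  have hpc_clopen : ∀ c, IsClopen {y | pc c y} := fun c => by
    constructor
    · rw [← isOpen_compl_iff]
      refine hsat_open _ fun u hu hu2 y => ?_
      simp only [Set.mem_compl_iff, Set.mem_setOf_eq, hmul_pc c u hu hu2 y]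
    · exact hsat_open _ fun u hu hu2 y => by simp only [Set.mem_setOf_eq, hmul_pc c u hu hu2 y]
  -- the pieces: clopen, inside `K`, `Ad K`-stable, left-`K(4)`-stable
  have hPK : ∀ c, P c ⊆ (cmLocalIntegralLevel L 3 H' v : Set ((cmDatum L 3 H').Local v)) := fun c y hy => by
    rw [hP c] at hy
    split_ifs at hy
    · exact hy.1
    · exact (hψK y).2 ((hpc _ _).1 hy).1
    · exact (hψK y).2 ((hpc _ _).1 hy).1
    · exact hy.1
  have hKclopen : IsClopen (cmLocalIntegralLevel L 3 H' v : Set ((cmDatum L 3 H').Local v)) := ⟨hKcl, hKo⟩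
  have hPclopen : ∀ c, IsClopen (P c) := fun c => by
    rw [hP c]; split_ifs
    · exact hKclopen.inter (hlev_clopen (-2))
    · exact hpc_clopen 1
    · exact hpc_clopen ε
    · exact hKclopen.inter hsq1_clopen.compl
  have hPo : ∀ c ∈ S, IsOpen (P c) := fun c _ => (hPclopen c).isOpen
  have hPcl : ∀ c ∈ S, IsClosed (P c) := fun c _ => (hPclopen c).isClosed
  have hPc : ∀ c ∈ S, IsCompact (P c) := fun c _ => hKc.of_isClosed_subset (hPclopen c).isClosed (hPK c)
  have hPconj : ∀ c, ∀ k ∈ cmLocalIntegralLevel L 3 H' v, ∀ y, k * y * k⁻¹ ∈ P c ↔ y ∈ P c := fun c k hk y => by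
    rw [hP c]; split_ifs <;> simp only [Set.mem_setOf_eq, hconjK k hk, hconj_lev k hk, hconj_sq1 k hk, hconj_pc _ k hk]
  -- left translation: the level conjuncts are read only inside `K`
  have hand : ∀ (p : (cmDatum L 3 H').Local v → Prop) (u : (cmDatum L 3 H').Local v), u ∈ cmLocalIntegralLevel L 3 H' v →
      (∀ y ∈ cmLocalIntegralLevel L 3 H' v, (p (u * y) ↔ p y)) →
      ∀ y, (u * y ∈ cmLocalIntegralLevel L 3 H' v ∧ p (u * y) ↔ y ∈ cmLocalIntegralLevel L 3 H' v ∧ p y) := fun p u huK hp y =>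
    ⟨fun h => ⟨(hmulK u huK y).1 h.1, (hp y ((hmulK u huK y).1 h.1)).1 h.2⟩, fun h => ⟨(hmulK u huK y).2 h.1, (hp y h.1).2 h.2⟩⟩
  have hPmul : ∀ c, ∀ u, u ∈ cmLocalIntegralLevel L 3 H' v → lev (-2) u → ∀ y, u * y ∈ P c ↔ y ∈ P c := fun c u huK hu2 y => by
    rw [hP c]; split_ifs
    · exact hand _ u huK (fun y hy => hmul_lev u hu2 y hy (-2) (Or.inr rfl)) y
    · exact hmul_pc 1 u huK hu2 y
    · exact hmul_pc ε u huK hu2 y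
    · exact hand (fun y => ¬ sq1 y) u huK (fun y hy => not_congr (hmul_sq1 u hu2 y hy)) y
  -- ## 3. The rank: the four values and the classification
  have hb_le : ∀ c, b c ≤ 3 := fun c => by rw [hb c]; split_ifs <;> omega
  have hb0 : ∀ c, b c = 0 ↔ ψ (Quotient.out c) = 1 := fun c => by
    rw [hb c]
    split_ifs with h0 <;> first | exact iff_of_true rfl h0 | exact iff_of_false (by decide) h0
  have hb1 : ∀ c, b c = 1 ↔ ¬ ψ (Quotient.out c) = 1 ∧ IsCj (ψ (Quotient.out c)) n₁ := fun c => by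
    rw [hb c]
    split_ifs with h0 h1 h2
    · exact iff_of_false (by decide) fun h => h.1 h0
    · exact iff_of_true rfl ⟨h0, h1⟩
    · exact iff_of_false (by decide) fun h => h1 h.2
    · exact iff_of_false (by decide) fun h => h1 h.2
  have hb2 : ∀ c, b c = 2 ↔ ¬ ψ (Quotient.out c) = 1 ∧ ¬ IsCj (ψ (Quotient.out c)) n₁ ∧ IsCj (ψ (Quotient.out c)) n₀ := fun c => by
    rw [hb c]
    split_ifs with h0 h1 h2
    · exact iff_of_false (by decide) fun h => h.1 h0
    · exact iff_of_false (by decide) fun h => h.2.1 h1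
    · exact iff_of_true rfl ⟨h0, h1, h2⟩
    · exact iff_of_false (by decide) fun h => h2 h.2.2
  -- the unipotent `ψ(out u)`, `u ∈ S`, is REGULAR when its rank is `3`
  have hreg3 : ∀ u ∈ S, b u = 3 →
      (((ψ (Quotient.out u) : GL (Fin 3) (w.1.adicCompletion L)) : Matrix (Fin 3) (Fin 3) (w.1.adicCompletion L)) - 1) *
        (((ψ (Quotient.out u) : GL (Fin 3) (w.1.adicCompletion L)) : Matrix (Fin 3) (Fin 3) (w.1.adicCompletion L)) - 1) ≠ 0 := by
    intro u _ h3 hsq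
    have hbu := hb u
    split_ifs at hbu with h0 h1 h2 <;> try omega
    rcases hsqcases _ (hψU _) hsq with h | h | h
    · exact h0 h
    · exact h1 h
    · exact h2 h
  -- ## 4. The table: diagonal representatives and above-diagonal zeros
  have hlev_one : ∀ y m, ψ y = 1 → lev m y := fun y m hy => by
    rw [hlev]; intro a c
    rw [hy, Units.val_one, sub_self, Matrix.zero_apply, map_zero]; exact zero_le
  have hPx : ∀ u ∈ S, ∃ x ∈ P u, ConjClasses.mk x = u := by
    intro u hu
    have hcases : b u = 0 ∨ b u = 1 ∨ b u = 2 ∨ b u = 3 := by have := hb_le u; omega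
    rcases hcases with h0 | h1 | h2 | h3
    · -- the class of `1`: `x = out u` itself lies in `K_w(2)`
      have hψ1 := (hb0 u).1 h0
      refine ⟨Quotient.out u, ?_, hout u⟩
      rw [hP u, if_pos h0]
      exact ⟨(hψK _).2 (by rw [hψ1, Units.val_one]; exact isIntMatrix_one), hlev_one _ _ hψ1⟩
    · -- `tv₁`: `x = ψ⁻¹ n(ϖ) ∈ P(1)`
      obtain ⟨k, hk, hkn⟩ := (hIsCj _ _).1 ((hb1 u).1 h1).2
      obtain ⟨x, hx⟩ := hψsurj n₁ hn₁U
      refine ⟨x, ?_, ?_⟩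
      · rw [hP u, if_neg (by omega), if_pos h1, Set.mem_setOf_eq, hpc, hx]
        exact cornerUnipotent_mem_residueSquareClassPiece (galAdicCompletionMap (L := L) (IsCMField.complexConj L) hw) (map_one _) hϖ1.le hϖ0 hn₁
      · rw [← hout u, hψconj]
        exact ⟨k⁻¹, inv_mem hk, by rw [hx, ← hkn]; group⟩
    · -- `tv_ε`: `x = ψ⁻¹ n(εϖ) ∈ P(ε)`
      obtain ⟨k, hk, hkn⟩ := (hIsCj _ _).1 ((hb2 u).1 h2).2.2
      obtain ⟨x, hx⟩ := hψsurj n₀ hn₀U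
      refine ⟨x, ?_, ?_⟩
      · rw [hP u, if_neg (by omega), if_neg (by omega), if_pos h2, Set.mem_setOf_eq, hpc, hx]
        exact cornerUnipotent_mem_residueSquareClassPiece (galAdicCompletionMap (L := L) (IsCMField.complexConj L) hw) hεv hϖ1.le hϖ0 hn₀
      · rw [← hout u, hψconj]
        exact ⟨k⁻¹, inv_mem hk, by rw [hx, ← hkn]; group⟩
    · -- `reg`: `x = ψ⁻¹ u(1, −½) ∈ R` (ONE regular class, ★ `exists_conj_eq_of_regular_unipotent`)
      have hreg := hreg3 u hu h3
      obtain ⟨k, hk, hkr⟩ := exists_conj_eq_of_regular_unipotent (galAdicCompletionMap (L := L) (IsCMField.complexConj L) hw) hσσ h2K (hψU _) hurU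
        ⟨3, hψnil u hu⟩ hurnil hreg hurreg
      obtain ⟨x, hx⟩ := hψsurj ur hurU
      refine ⟨x, ?_, ?_⟩
      · rw [hP u, if_neg (by omega), if_neg (by omega), if_neg (by omega)]
        exact ⟨(hψK x).2 (by rw [hx]; exact hurint), fun h => not_forall_v_upperUnipotentOne_sub_one_sq_apply_le hur hexp1lt (by rw [← hx]; exact (hsq1 x).1 h)⟩
      · rw [← hout u, hψconj]
        exact ⟨k⁻¹, inv_mem hk, by rw [hx, ← hkr]; group⟩
  have hbinj : Set.InjOn b ↑S := by
    intro c hc c' hc' hcc'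
    rw [Finset.mem_coe] at hc hc'
    suffices hk : IsCj (ψ (Quotient.out c)) (ψ (Quotient.out c')) by
      rw [← hout c, ← hout c']
      exact (hψconj _ _).2 ((hIsCj _ _).1 hk)
    rw [hIsCj]
    have hcases : b c = 0 ∨ b c = 1 ∨ b c = 2 ∨ b c = 3 := by have := hb_le c; omega
    rcases hcases with h0 | h1 | h2 | h3
    · refine ⟨1, one_mem _, ?_⟩
      rw [(hb0 c).1 h0, (hb0 c').1 (by omega), mul_one, one_mul, inv_one]
    · obtain ⟨k, hk, hkn⟩ := (hIsCj _ _).1 ((hb1 c).1 h1).2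
      obtain ⟨k', hk', hkn'⟩ := (hIsCj _ _).1 ((hb1 c').1 (by omega)).2
      refine ⟨k'⁻¹ * k, mul_mem (inv_mem hk') hk, ?_⟩
      rw [show k'⁻¹ * k * ψ (Quotient.out c) * (k'⁻¹ * k)⁻¹ = k'⁻¹ * (k * ψ (Quotient.out c) * k⁻¹) * k' by group, hkn, ← hkn']
      group
    · obtain ⟨k, hk, hkn⟩ := (hIsCj _ _).1 ((hb2 c).1 h2).2.2
      obtain ⟨k', hk', hkn'⟩ := (hIsCj _ _).1 ((hb2 c').1 (by omega)).2.2
      refine ⟨k'⁻¹ * k, mul_mem (inv_mem hk') hk, ?_⟩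
      rw [show k'⁻¹ * k * ψ (Quotient.out c) * (k'⁻¹ * k)⁻¹ = k'⁻¹ * (k * ψ (Quotient.out c) * k⁻¹) * k' by group, hkn, ← hkn']
      group
    · exact exists_conj_eq_of_regular_unipotent (galAdicCompletionMap (L := L) (IsCMField.complexConj L) hw) hσσ h2K (hψU _) (hψU _)
        ⟨3, hψnil c hc⟩ ⟨3, hψnil c' hc'⟩ (hreg3 c hc h3) (hreg3 c' hc' (by omega))
  have hsep : ∀ u ∈ S, ∀ u' ∈ S, b u < b u' → ∀ y ∈ P u', ConjClasses.mk y ≠ u := by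
    intro u hu u' _ hlt y hy hyu
    -- `y ∼ out u`: `ψ y = k ψ(out u) k⁻¹` with `k ∈ U(σ_w, J₀)`
    obtain ⟨k, hk, hky⟩ := (hψconj (Quotient.out u) y).1 (by rw [hout u, hyu])
    have hy1 : b u = 0 → ψ y = 1 := fun h0 => by rw [← hky, (hb0 u).1 h0, mul_one, mul_inv_cancel]
    have hyn₁ : b u = 1 → ∃ k₁ : GL (Fin 3) (w.1.adicCompletion L), k₁ ∈ unitaryGroupOfForm (galAdicCompletionMap (L := L) (IsCMField.complexConj L) hw) ((StdForm.antidiagonal 3).over (w.1.adicCompletion L)) ∧ ψ y = k₁ * n₁ * k₁⁻¹ := fun h1 => by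
      obtain ⟨k₁, hk₁, hk₁n⟩ := (hIsCj _ _).1 ((hb1 u).1 h1).2
      exact ⟨k * k₁⁻¹, mul_mem hk (inv_mem hk₁), by rw [← hky, ← hk₁n]; group⟩
    have hyn₀ : b u = 2 → ∃ k₀ : GL (Fin 3) (w.1.adicCompletion L), ψ y = k₀ * n₀ * k₀⁻¹ := fun h2 => by
      obtain ⟨k₀, -, hk₀n⟩ := (hIsCj _ _).1 ((hb2 u).1 h2).2.2
      exact ⟨k * k₀⁻¹, by rw [← hky, ← hk₀n]; group⟩
    rw [hP u'] at hy
    have hcases : b u' = 1 ∨ b u' = 2 ∨ b u' = 3 := by have := hb_le u'; omega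
    rcases hcases with h1 | h2 | h3
    · -- `P u' = P(1)` misses the class of `1`
      rw [if_neg (by omega), if_pos h1, Set.mem_setOf_eq, hpc, hy1 (by omega)] at hy
      exact one_not_mem_residueSquareClassPiece (galAdicCompletionMap (L := L) (IsCMField.complexConj L) hw) hvσ (map_one _) hy.2.2
    · -- `P u' = P(ε)` misses the class of `1` and — THE RESIDUE-SQUARE-CLASS ROW — the class of `n(ϖ)`
      rw [if_neg (by omega), if_neg (by omega), if_pos h2, Set.mem_setOf_eq, hpc] at hy
      have hbu : b u = 0 ∨ b u = 1 := by omega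
      rcases hbu with h0 | h1
      · rw [hy1 h0] at hy
        exact one_not_mem_residueSquareClassPiece (galAdicCompletionMap (L := L) (IsCMField.complexConj L) hw) hvσ hεv hy.2.2
      · obtain ⟨k₁, hk₁, hψy⟩ := hyn₁ h1
        rw [hψy] at hy
        exact conj_cornerUnipotent_not_mem_residueSquareClassPiece (galAdicCompletionMap (L := L) (IsCMField.complexConj L) hw) hvσ hεv hε' hn₁' hk₁ hy.2.2
    · -- `P u' = R` misses the classes of `1`, `n(ϖ)`, `n(εϖ)` (all square-zero)
      rw [if_neg (by omega), if_neg (by omega), if_neg (by omega), Set.mem_setOf_eq] at hy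
      apply hy.2
      have hsq0 : (((ψ y : GL (Fin 3) (w.1.adicCompletion L)) : Matrix (Fin 3) (Fin 3) (w.1.adicCompletion L)) - 1) *
          (((ψ y : GL (Fin 3) (w.1.adicCompletion L)) : Matrix (Fin 3) (Fin 3) (w.1.adicCompletion L)) - 1) = 0 := by
        have hbu : b u = 0 ∨ b u = 1 ∨ b u = 2 := by omega
        rcases hbu with h0 | h1 | h2
        · rw [hy1 h0, Units.val_one, sub_self, Matrix.zero_mul]
        · obtain ⟨k₁, -, hψy⟩ := hyn₁ h1
          rw [hψy]; exact conj_cornerUnipotent_sub_one_mul_self hn₁ _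
        · obtain ⟨k₀, hψy⟩ := hyn₀ h2
          rw [hψy]; exact conj_cornerUnipotent_sub_one_mul_self hn₀ _
      rw [hsq1]
      intro a c
      rw [hsq0, Matrix.zero_apply, map_zero]; exact zero_le
  -- ## 5. Assembly (the socket's `v`-level-1 token is `lev (−2)` at a ramified place: `|ι ϖ_v|_w = exp(−2)`)
  have he2 := Liu2021.LemD1IndexedNonVacuityRamifiedPlace.ramificationIdx'_eq_two_of_ne_one L v (IsCMField.complexConj L) (IsCMField.complexConj_ne_one L) w hw he
  have hιϖ : Valued.v (toPlace v w (HeckeCharacter.uniformizer ↥(maximalRealSubfield L) v : v.adicCompletion ↥(maximalRealSubfield L))) = WithZero.exp (-2 : ℤ) := by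
    rw [valued_toPlace_of_ramificationIdx'_eq_two L v w he2, HeckeCharacter.valued_uniformizer, ← WithZero.exp_nsmul]; norm_num
  have hιϖ2 : Valued.v ((toPlace v w (HeckeCharacter.uniformizer ↥(maximalRealSubfield L) v : v.adicCompletion ↥(maximalRealSubfield L))) ^ 1) =
      WithZero.exp (-2 : ℤ) := by rw [pow_one, hιϖ]
  have hιϖ0 : ((toPlace v w (HeckeCharacter.uniformizer ↥(maximalRealSubfield L) v : v.adicCompletion ↥(maximalRealSubfield L))) ^ 1) ≠ 0 := by
    intro h0; rw [h0, map_zero] at hιϖ2; exact WithZero.zero_ne_coe hιϖ2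
  have htoken : ∀ u : (cmDatum L 3 H').Local v,
      (∀ a b, Valued.v (((toPlace v w (HeckeCharacter.uniformizer ↥(maximalRealSubfield L) v : v.adicCompletion ↥(maximalRealSubfield L))) ^ 1)⁻¹ *
        ((((localNonsplitEquiv (IsCMField.complexConj L) H' (IsCMField.complexConj_ne_one L) w hw u :
            ↥(unitaryGroupOfForm (galAdicCompletionMap (L := L) (IsCMField.complexConj L) hw) (placeForm H' w.1))) : GL (Fin 3) (w.1.adicCompletion L)) : Matrix (Fin 3) (Fin 3) (w.1.adicCompletion L)) a b - (1 : Matrix (Fin 3) (Fin 3) (w.1.adicCompletion L)) a b)) ≤ 1) → lev (-2) u := by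
    intro u hu
    rw [hlev, hψ]
    rw [forall_v_conj_sub_one_apply_le_iff hTi hTii]
    intro a b
    have h := hu a b
    rw [v_inv_mul_le_one_iff hιϖ0, hιϖ2, ← Matrix.sub_apply] at h
    exact h
  refine ⟨fun u => (P u).indicator fun _ => (1 : ℂ), fun i => isLocSmooth_indicator (hPo i i.2) (hPcl i i.2) (hPc i i.2), fun i => ?_, fun i u hu x => ?_,
    fun i u hu x => ?_, det_classOrbitalIntegral_indicator_ne_zero S mU hmU hRao P hPo hPc hPcl hPx b hbinj hsep⟩
  · -- support inside `K`
    exact hKcl.closure_subset_iff.2 (Set.support_indicator_subset.trans (hPK i))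
  · -- `Ad K`-invariance
    show (P i).indicator (fun _ => (1 : ℂ)) (u * x * u⁻¹) = (P i).indicator (fun _ => (1 : ℂ)) x
    by_cases hx : x ∈ P i
    · rw [Set.indicator_of_mem hx, Set.indicator_of_mem ((hPconj i u hu x).2 hx)]
    · rw [Set.indicator_of_notMem hx, Set.indicator_of_notMem (fun h => hx ((hPconj i u hu x).1 h))]
  · -- left-invariance under the level set `{ψ ≡ 1 (ι ϖ_v)} = K_w(2)`
    have hu2 : lev (-2) u := htoken u hu
    have huK : u ∈ cmLocalIntegralLevel L 3 H' v := by
      rw [hψK]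
      refine isIntMatrix_of_forall_v_sub_one_lt_one _ fun a b => lt_of_le_of_lt ((hlev (-2) u).1 hu2 a b) ?_
      rw [← WithZero.exp_zero]; exact WithZero.exp_lt_exp.2 (by norm_num)
    show (P i).indicator (fun _ => (1 : ℂ)) (u * x) = (P i).indicator (fun _ => (1 : ℂ)) x
    by_cases hx : x ∈ P i
    · rw [Set.indicator_of_mem hx, Set.indicator_of_mem ((hPmul i u huK hu2 x).2 hx)]
    · rw [Set.indicator_of_notMem hx, Set.indicator_of_notMem (fun h => hx ((hPmul i u huK hu2 x).1 h))]

end Literature.NumberTheory.Rogawski1990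

end
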